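import Summits.QuantumAdvantage.AdviceFreeQNC0.AffBells28SubFibre
import Summits.QuantumAdvantage.AdviceFreeQNC0.AffBells29Peeling
import Literature.Computability.MetaComplexity.ModThreeTestAnf
import HarnessLib

/-!
# (W1) The TOP REDUCED ANF COEFFICIENT of a sub-fibre system: `SysConst ⟹ topCoeff ≡ 0 (mod 2)`, with `topCoeff`
# an explicit XOR over rows of single `MOD₃` tests of the base point OFF the window (sketch by qn-lit g28 for P-28c)

Setting (tree, `AffBells28SubFibre.lean` = Sketch28 §28.1–§28.3): `x` odd, a window `C ⊆ klineZeros x` of coins,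
the sub-fibre `SubFibre x C` = the `2^{|C|-1}` even coin flips `flipAt x P` (`P ⊆ C`, `|P|` even) of `x`
(`subFibre_eq_image`, from `AffBells26.kline_flipAt_coins`), rows `R` with offsets `c`, `fires β c R x'` = number of
rows of `R` whose test `[form β x' g = c g]` fires, `SysConst β c R x C` = the XOR of these tests is constant on the
sub-fibre (`subFibreBridge : AllWin → SysConst (act x)`).

What is proved here (0 sorry; imports only the landed `AffBells28SubFibre` and the Literature file
`ModThreeTestAnf` = the `𝔽₂`-ANF of one `MOD₃` test and the parity-class double count):

* `form_flipAt` — `form β (flipAt x P) g = form β x g + Σ_{i∈P} sdelta β x g i` (signed coefficients).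
* `aTop β c R x S := #{g ∈ R : (∀ i ∈ S, β g i ≠ 0) ∧ Σ_{i∈S} β g i + c g ≠ offForm β S x g}` and
  `sum_fires_cube_eq_aTop` — for `S ≠ ∅`, `Σ_{P ⊆ S} fires β c R (flipAt x P) ≡ aTop β c R x S (mod 2)`: `aTop` IS the
  top `𝔽₂`-ANF coefficient (binary Möbius transform over the FULL coin cube on `S`, odd and even flips) of the XOR of
  the tests, in CLOSED FORM: the parity of the number of rows reading every coin of `S` (non-zero coefficients) whose
  SHIFTED OFF-WINDOW TEST `[offForm β S x g = c g + Σ_{i∈S} β g i]` FAILS.  Each such test is a single `MOD₃` test of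
  the bits of `x` off `S` (`aTop_add_card` spells `aTop ≡ #full readers + #firing shifted tests`): this is the hook
  for the character-sum bound `ModTestProduct.abs_card_even_sub_card_odd_le` (W2, landed) in the dense regime.
* `topCoeff β c R x C := (|C| + 1)·aTop(C) + Σ_{i∈C} aTop(C ∖ i)` and **`sum_fires_eq_topCoeff`** — for `|C| ≥ 2`,
  `Σ_{x' ∈ SubFibre x C} fires β c R x' ≡ topCoeff β c R x C (mod 2)` (the parity-class double count
  `ModThreeAnf.parityClass_top` with `π = 0` in the flip variables, then the closed form per row): `topCoeff` is the
  top ANF coefficient of the XOR of the tests RESTRICTED to the sub-fibre (qn-lit S-28W `ã_top`, here in the flip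
  parametrisation, so no class parity `π` appears; the `x_i`-dependence sits in `offForm β (C∖i) x g`).
* **`topCoeff_even_of_sysConst`** — `SysConst β c R x C`, `|C| ≥ 2` ⟹ `topCoeff β c R x C ≡ 0 (mod 2)` (constant parity
  on `2^{|C|-1}` points, an even number; done as a fixed-point-free involution `x' ↦ flipAt x' {a,b}`);
  `topCoeff_even_subwindow` — hence also at every base point `x₁ ∈ SubFibre x C` and every sub-window `C' ⊆ C`,
  `|C'| ≥ 2`: ALL reduced ANF coefficients of order `≥ 1` vanish (the coefficient of `y^T`, `T ⊆ C ∖ i₀` non-empty, of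
  the restriction is `topCoeff` of the sub-window `T ∪ {i₀}` at the base point zeroed accordingly).
* **`exists_loss_of_topCoeff_odd`** — the usable direction: `topCoeff β c (act x) x C` ODD ⟹ some point of
  `SubFibre x C` LOSES (contrapositive + `subFibreBridge`).  A decidable, class-free, move-free certificate.

Relation to Sketch29 (qn-p1 g29) `CubeWitness`: both are Möbius (sub-cube) sums of `fires`; `CubeWitness` sums over the
`2^{|L|}` points of a cube of disjoint PAIR MOVES and compares with `#surv` (absolute peel), `topCoeff` sums over the WHOLE
sub-fibre and comes with the closed form above (no survivors / shifted offsets to track: the rows that matter are the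
FULL READERS of `C` and of each `C ∖ i`, i.e. rows of weight `≥ |C| - 1` on the window — for `|C| = K log₂ N` and
sparse rows this coefficient is generically `0`, and the LOWER reduced coefficients = `topCoeff` of small sub-windows
`C'` (`topCoeff_even_subwindow`, `|C'| = 2, 3, …`) are the ones that fire; `|C'| = 2` is exactly the slope/pair level).

NOT claimed: any density statement (`HIso`/`HCube`); this file is the parity ALGEBRA only.
-/

namespace Summit.QuantumAdvantage.AdviceFreeQNC0

namespace AffBells28lit

open Finset Literature.Computability.QuantumComplexity Literature.Computability.QuantumComplexity.RingHLF
open AffBells23 AffBells26 Fib19 AffBells27 AffBells28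
open Literature.Computability.MetaComplexity.ModThreeAnf

variable {N : ℕ}

/-! ### 1. Forms under coin flips -/

/-- The SIGNED coefficient of coin `i` in row `g` at `x`: the change of `form β · g` when bit `i` of `x` is flipped
(`false → true` adds `β g i`, `true → false` subtracts it). -/
def sdelta (β : Fin N → Fin N → ZMod 3) (x : Fin N → Bool) (g i : Fin N) : ZMod 3 :=
  if x i then -β g i else β g i

/-- The form after flipping the set `P` of bits: `form β (flipAt x P) g = form β x g + Σ_{i∈P} sdelta β x g i`. -/
theorem form_flipAt (β : Fin N → Fin N → ZMod 3) (x : Fin N → Bool) (g : Fin N) (P : Finset (Fin N)) :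
    form β (flipAt x P) g = form β x g + ∑ i ∈ P, sdelta β x g i := by
  have hP : (∑ i ∈ P, sdelta β x g i) = ∑ i, if i ∈ P then sdelta β x g i else 0 := by
    rw [sum_ite_mem, univ_inter]
  unfold form
  rw [hP, ← sum_add_distrib]
  refine sum_congr rfl fun i _ => ?_
  unfold sdelta
  by_cases hi : i ∈ P
  · rw [flipAt_apply_of_mem hi, if_pos hi]
    cases hx : x i <;> simp
  · rw [flipAt_apply_of_not_mem hi, if_neg hi, add_zero]

/-- Splitting the form along a coin set: `form β x g = offForm β S x g + Σ_{i ∈ S, x i} β g i`. -/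
theorem form_eq_offForm_add (β : Fin N → Fin N → ZMod 3) (S : Finset (Fin N)) (x : Fin N → Bool) (g : Fin N) :
    form β x g = offForm β S x g + ∑ i ∈ S, if x i then β g i else 0 := by
  unfold form offForm
  exact (sum_sdiff (subset_univ S)).symm

/-- `-b = b + b` in `ℤ/3`. -/
private theorem neg_eq_add_self_zmod3 : ∀ b : ZMod 3, -b = b + b := by decide

/-- The signed coefficients summed over `S`: `Σ_{i∈S} sdelta = Σ_{i∈S} β g i + Σ_{i∈S, x i} β g i` (in `ℤ/3`, `-β = 2β`). -/
theorem sum_sdelta_eq (β : Fin N → Fin N → ZMod 3) (x : Fin N → Bool) (g : Fin N) (S : Finset (Fin N)) :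
    (∑ i ∈ S, sdelta β x g i) = (∑ i ∈ S, β g i) + ∑ i ∈ S, if x i then β g i else 0 := by
  rw [← sum_add_distrib]
  refine sum_congr rfl fun i _ => ?_
  unfold sdelta
  cases hx : x i
  · simp
  · simp [neg_eq_add_self_zmod3]

/-- Translating the closed form of `ModThreeAnf.anf_modThreeTest` (in the signed coefficients and the offset
`c g - form β x g`) into the window language: full readers of `S` whose shifted off-`S` test fails. -/
theorem cond_iff (β : Fin N → Fin N → ZMod 3) (c : Fin N → ZMod 3) (x : Fin N → Bool) (g : Fin N)
    (S : Finset (Fin N)) :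
    ((∀ i ∈ S, sdelta β x g i ≠ 0) ∧ (∑ i ∈ S, sdelta β x g i) + (c g - form β x g) ≠ 0) ↔
      ((∀ i ∈ S, β g i ≠ 0) ∧ (∑ i ∈ S, β g i) + c g ≠ offForm β S x g) := by
  have h1 : ∀ i, sdelta β x g i ≠ 0 ↔ β g i ≠ 0 := fun i => by
    unfold sdelta
    cases hx : x i <;> simp
  have h2 : (∑ i ∈ S, sdelta β x g i) + (c g - form β x g) = (∑ i ∈ S, β g i) + c g - offForm β S x g := by
    rw [sum_sdelta_eq, form_eq_offForm_add β S x g]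
    ring
  simp only [h1, h2, sub_ne_zero]

/-! ### 2. The top ANF coefficient over a full coin cube, in closed form -/

/-- **`aTop`**: the number of rows of `R` that read EVERY coin of `S` (non-zero coefficients) and whose shifted
off-window test `[offForm β S x g = c g + Σ_{i∈S} β g i]` FAILS.  Mod 2 this is the top `𝔽₂`-ANF coefficient of the
XOR of the tests of `R` over the full coin cube on `S` (`sum_fires_cube_eq_aTop`).  Depends on `x` only off `S`. -/
def aTop (β : Fin N → Fin N → ZMod 3) (c : Fin N → ZMod 3) (R : Finset (Fin N)) (x : Fin N → Bool)
    (S : Finset (Fin N)) : ℕ :=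
  (R.filter fun g => (∀ i ∈ S, β g i ≠ 0) ∧ (∑ i ∈ S, β g i) + c g ≠ offForm β S x g).card

/-- `aTop` as a XOR of `MOD₃` tests OFF the window: `aTop + #{full readers whose shifted off-S test FIRES} = #full readers`
(so `aTop ≡ #full readers of S + #{g full reader : offForm β S x g = c g + Σ_{i∈S} β g i} (mod 2)`). -/
theorem aTop_add_card (β : Fin N → Fin N → ZMod 3) (c : Fin N → ZMod 3) (R : Finset (Fin N)) (x : Fin N → Bool)
    (S : Finset (Fin N)) :
    aTop β c R x S +
        ((R.filter fun g => ∀ i ∈ S, β g i ≠ 0).filter fun g => (∑ i ∈ S, β g i) + c g = offForm β S x g).card =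
      (R.filter fun g => ∀ i ∈ S, β g i ≠ 0).card := by
  unfold aTop
  have h := card_filter_add_card_filter_not (s := R.filter fun g => ∀ i ∈ S, β g i ≠ 0)
    (fun g => (∑ i ∈ S, β g i) + c g = offForm β S x g)
  rw [filter_filter, filter_filter] at h
  rw [filter_filter, add_comm]
  exact h

/-- One row over the full cube on `S ≠ ∅`: `Σ_{P ⊆ S} [form β (flipAt x P) g = c g] ≡ [g full reader of S ∧ shifted
off-S test fails] (mod 2)` (`ModThreeAnf.anf_modThreeTest` for the signed coefficients). -/
theorem row_cube_sum (β : Fin N → Fin N → ZMod 3) (c : Fin N → ZMod 3) (x : Fin N → Bool) (g : Fin N)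
    {S : Finset (Fin N)} (hS : S ≠ ∅) :
    (∑ P ∈ S.powerset, if form β (flipAt x P) g = c g then (1 : ZMod 2) else 0) =
      if (∀ i ∈ S, β g i ≠ 0) ∧ (∑ i ∈ S, β g i) + c g ≠ offForm β S x g then 1 else 0 := by
  have hiff : ∀ s : ZMod 3, (form β x g + s = c g) ↔ (s = c g - form β x g) := fun s =>
    ⟨fun h => by rw [← h]; ring, fun h => by rw [h]; ring⟩
  simp only [form_flipAt, hiff]
  rw [anf_modThreeTest (sdelta β x g) (c g - form β x g) S, if_neg hS]
  simp only [cond_iff]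

/-- **`aTop` is the top ANF coefficient over the full cube**: for `S ≠ ∅`,
`Σ_{P ⊆ S} fires β c R (flipAt x P) ≡ aTop β c R x S (mod 2)`. -/
theorem sum_fires_cube_eq_aTop (β : Fin N → Fin N → ZMod 3) (c : Fin N → ZMod 3) (R : Finset (Fin N))
    (x : Fin N → Bool) {S : Finset (Fin N)} (hS : S ≠ ∅) :
    (((∑ P ∈ S.powerset, fires β c R (flipAt x P) : ℕ) : ZMod 2)) = (aTop β c R x S : ZMod 2) := by
  unfold fires aTop
  simp only [card_filter, Nat.cast_sum, Nat.cast_ite, Nat.cast_one, Nat.cast_zero]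
  rw [sum_comm]
  exact sum_congr rfl fun g _ => row_cube_sum β c x g hS

/-! ### 3. The top REDUCED coefficient: the sum over the sub-fibre -/

/-- **`topCoeff`**: `(|C| + 1)·aTop(C) + Σ_{i ∈ C} aTop(C ∖ i)` — mod 2, the top ANF coefficient of the XOR of the tests of
`R` restricted to the sub-fibre `SubFibre x C` (`sum_fires_eq_topCoeff`).  A XOR over rows of single shifted `MOD₃` tests
of `x` off the window (`aTop_add_card`).  Decidable. -/
def topCoeff (β : Fin N → Fin N → ZMod 3) (c : Fin N → ZMod 3) (R : Finset (Fin N)) (x : Fin N → Bool)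
    (C : Finset (Fin N)) : ℕ :=
  (C.card + 1) * aTop β c R x C + ∑ i ∈ C, aTop β c R x (C.erase i)

/-- One row over the EVEN flips of `C` (`|C| ≥ 2`): `Σ_{P ⊆ C, |P| even} [test_g fires at flipAt x P] ≡
(|C|+1)·[g ∈ aTop-set of C] + Σ_{i∈C} [g ∈ aTop-set of C ∖ i] (mod 2)` (`ModThreeAnf.parityClass_top` with `π = 0`). -/
theorem row_class_sum (β : Fin N → Fin N → ZMod 3) (c : Fin N → ZMod 3) (x : Fin N → Bool) (g : Fin N)
    {C : Finset (Fin N)} (hC : 2 ≤ C.card) :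
    (∑ P ∈ C.powerset with P.card % 2 = 0, if form β (flipAt x P) g = c g then (1 : ZMod 2) else 0) =
      ((C.card : ZMod 2) + 1) *
          (if (∀ i ∈ C, β g i ≠ 0) ∧ (∑ i ∈ C, β g i) + c g ≠ offForm β C x g then 1 else 0) +
        ∑ i ∈ C, if (∀ k ∈ C.erase i, β g k ≠ 0) ∧ (∑ k ∈ C.erase i, β g k) + c g ≠ offForm β (C.erase i) x g
          then 1 else 0 := by
  have hCne : C ≠ ∅ := by
    rintro rfl
    simp at hC
  have h := parityClass_top (fun P => if form β (flipAt x P) g = c g then (1 : ZMod 2) else 0) C 0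
  simp only [Nat.zero_mod, zero_add, Nat.cast_add, Nat.cast_one] at h
  rw [h, row_cube_sum β c x g hCne]
  congr 1
  refine sum_congr rfl fun i hi => ?_
  have hne : C.erase i ≠ ∅ := by
    intro h'
    have := card_erase_of_mem hi
    rw [h', card_empty] at this
    omega
  exact row_cube_sum β c x g hne

/-! ### 4. The sub-fibre as the even coin flips of the base point -/

/-- `flipAt x` is injective in the flip set. -/
theorem flipAt_injective (x : Fin N → Bool) : Function.Injective (flipAt x) := by
  intro P Q h
  ext i
  have hi := congrFun h i
  unfold flipAt at hi
  by_cases hP : i ∈ P <;> by_cases hQ : i ∈ Q <;> cases hx : x i <;> simp_all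

/-- **Parametrisation of the sub-fibre**: for `x` odd and `C` a set of coins, `SubFibre x C` is exactly the set of even
flips `flipAt x P`, `P ⊆ C`, `|P|` even (`kline_flipAt_coins` one way; the other way the flip set is `{i ∈ C : x' i ≠ x i}`,
even because both points are odd). -/
theorem subFibre_eq_image (hN : 3 ≤ N) {x : Fin N → Bool} (hx : IsOdd x) {C : Finset (Fin N)}
    (hC : C ⊆ klineZeros x) :
    SubFibre x C = (C.powerset.filter fun P => P.card % 2 = 0).image (flipAt x) := by
  ext x'
  simp only [SubFibre, mem_filter, mem_univ, true_and, mem_image, mem_powerset]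
  constructor
  · rintro ⟨hodd, hk, hoff⟩
    have heq : flipAt x (C.filter fun i => x' i ≠ x i) = x' := by
      funext i
      by_cases hi : i ∈ C.filter fun i => x' i ≠ x i
      · rw [flipAt_apply_of_mem hi]
        have hne : x' i ≠ x i := (mem_filter.1 hi).2
        cases hx' : x' i <;> cases hxi : x i <;> simp_all
      · rw [flipAt_apply_of_not_mem hi]
        by_cases hiC : i ∈ C
        · by_contra hne
          exact hi (mem_filter.2 ⟨hiC, fun h => hne h.symm⟩)
        · exact (hoff i hiC).symm
    refine ⟨C.filter fun i => x' i ≠ x i, ⟨filter_subset _ _, ?_⟩, heq⟩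
    rcases Nat.mod_two_eq_zero_or_one (C.filter fun i => x' i ≠ x i).card with h0 | h1
    · exact h0
    · exact absurd hx ((isOdd_flipAt_of_odd x _ h1).1 (by rw [heq]; exact hodd))
  · rintro ⟨P, ⟨hPC, heven⟩, rfl⟩
    obtain ⟨hodd', hk'⟩ :=
      kline_flipAt_coins hN x hx P (fun k hk => (mem_filter.1 (hC (hPC hk))).2) heven
    exact ⟨hodd', hk', fun i hi => flipAt_apply_of_not_mem fun h => hi (hPC h)⟩

/-- Sums over the sub-fibre as sums over even flip sets. -/
theorem sum_subFibre_eq_sum_even {M : Type*} [AddCommMonoid M] (hN : 3 ≤ N) {x : Fin N → Bool} (hx : IsOdd x)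
    {C : Finset (Fin N)} (hC : C ⊆ klineZeros x) (φ : (Fin N → Bool) → M) :
    (∑ x' ∈ SubFibre x C, φ x') = ∑ P ∈ C.powerset with P.card % 2 = 0, φ (flipAt x P) := by
  rw [subFibre_eq_image hN hx hC, sum_image fun P _ Q _ h => flipAt_injective x h]

/-- **THE IDENTITY (W1-top).**  For `x` odd, coins `C ⊆ klineZeros x` with `|C| ≥ 2`, any rows `R` and offsets `c`:
`Σ_{x' ∈ SubFibre x C} fires β c R x' ≡ topCoeff β c R x C (mod 2)`. -/
theorem sum_fires_eq_topCoeff (hN : 3 ≤ N) (β : Fin N → Fin N → ZMod 3) (c : Fin N → ZMod 3) (R : Finset (Fin N))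
    {x : Fin N → Bool} (hx : IsOdd x) {C : Finset (Fin N)} (hC : C ⊆ klineZeros x) (h2 : 2 ≤ C.card) :
    (((∑ x' ∈ SubFibre x C, fires β c R x' : ℕ) : ZMod 2)) = (topCoeff β c R x C : ZMod 2) := by
  rw [sum_subFibre_eq_sum_even hN hx hC]
  unfold fires topCoeff aTop
  simp only [card_filter, Nat.cast_sum, Nat.cast_add, Nat.cast_mul, Nat.cast_ite, Nat.cast_one, Nat.cast_zero]
  rw [sum_comm, sum_congr rfl fun g _ => row_class_sum β c x g h2, sum_add_distrib, ← mul_sum, sum_comm]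

/-! ### 5. Constancy forces an even sum: `SysConst ⟹ topCoeff ≡ 0` -/

/-- `a + a = 0` in `𝔽₂`. -/
private theorem add_self_zmod2 : ∀ a : ZMod 2, a + a = 0 := by decide

/- `pair_mem_subFibre` omitted by the lander: identical to the landed `AffBells29.flipAt_pair_mem_subFibre` (AffBells29Peeling.lean). -/

/-- Under `SysConst` (and `|C| ≥ 2`) the sub-fibre sum of `fires` is EVEN: pair the points by the fixed-point-free
involution `x' ↦ flipAt x' {a, b}` (`a ≠ b` coins of `C`); paired values have equal parity. -/
theorem sum_fires_eq_zero_of_sysConst (hN : 3 ≤ N) (β : Fin N → Fin N → ZMod 3) (c : Fin N → ZMod 3)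
    (R : Finset (Fin N)) {x : Fin N → Bool} {C : Finset (Fin N)} (hC : C ⊆ klineZeros x) (h2 : 2 ≤ C.card)
    (hS : SysConst β c R x C) :
    (((∑ x' ∈ SubFibre x C, fires β c R x' : ℕ) : ZMod 2)) = 0 := by
  obtain ⟨a, ha, b, hb, hab⟩ := one_lt_card.1 h2
  rw [Nat.cast_sum]
  refine sum_involution (fun x' _ => flipAt x' {a, b}) ?_ ?_ ?_ ?_
  · intro x' hx'
    have h := hS x' hx' _ (AffBells29.flipAt_pair_mem_subFibre hN hC hx' ha hb hab)
    rw [(ZMod.natCast_eq_natCast_iff' _ _ 2).2 h]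
    exact add_self_zmod2 _
  · intro x' _ _ h
    have ha' := congrFun h a
    rw [flipAt_apply_of_mem (mem_insert_self a {b})] at ha'
    revert ha'
    cases x' a <;> decide
  · intro x' hx'
    exact AffBells29.flipAt_pair_mem_subFibre hN hC hx' ha hb hab
  · intro x' _
    exact flipAt_flipAt x' {a, b}

/-- **(W1-top) `SysConst ⟹ topCoeff ≡ 0 (mod 2)`.** -/
theorem topCoeff_even_of_sysConst (hN : 3 ≤ N) (β : Fin N → Fin N → ZMod 3) (c : Fin N → ZMod 3)
    (R : Finset (Fin N)) {x : Fin N → Bool} (hx : IsOdd x) {C : Finset (Fin N)} (hC : C ⊆ klineZeros x)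
    (h2 : 2 ≤ C.card) (hS : SysConst β c R x C) : topCoeff β c R x C % 2 = 0 := by
  have h := sum_fires_eq_topCoeff hN β c R hx hC h2
  rw [sum_fires_eq_zero_of_sysConst hN β c R hC h2 hS] at h
  have h' := (ZMod.natCast_eq_natCast_iff' 0 (topCoeff β c R x C) 2).1 (by rw [Nat.cast_zero]; exact h)
  omega

/-- **The certificate direction.**  If `topCoeff β c (act x) x C` is ODD then some point of the sub-fibre LOSES
(contrapositive of `topCoeff_even_of_sysConst` and of the bridge `subFibreBridge : AllWin → SysConst (act x)`). -/
theorem exists_loss_of_topCoeff_odd (hN : 3 ≤ N) (β : Fin N → Fin N → ZMod 3) (c : Fin N → ZMod 3)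
    {x : Fin N → Bool} (hx : IsOdd x) {C : Finset (Fin N)} (hC : C ⊆ klineZeros x) (h2 : 2 ≤ C.card)
    (hodd : topCoeff β c (act x) x C % 2 = 1) : ∃ x' ∈ SubFibre x C, ¬ RingHLF.Rel x' (affBell β c x') := by
  by_contra hall
  push Not at hall
  have hS : SysConst β c (act x) x C := subFibreBridge hN β c x C hall
  have := topCoeff_even_of_sysConst hN β c (act x) hx hC h2 hS
  omega

/-! ### 6. All reduced coefficients: sub-windows at every base point -/

/- `subFibre_subset_of_mem'` omitted by the lander: identical to the landed `AffBells28.subFibre_subset_of_mem` (AffBells28PeelingList.lean). -/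

/-- Constancy descends to every sub-window at every base point of the sub-fibre. -/
theorem sysConst_subwindow (β : Fin N → Fin N → ZMod 3) (c : Fin N → ZMod 3) (R : Finset (Fin N))
    {x x₁ : Fin N → Bool} {C C' : Finset (Fin N)} (hS : SysConst β c R x C) (hx₁ : x₁ ∈ SubFibre x C)
    (hC' : C' ⊆ C) : SysConst β c R x₁ C' :=
  fun y hy y' hy' => hS y (subFibre_subset_of_mem hx₁ (subFibre_mono hC' hy)) y'
    (subFibre_subset_of_mem hx₁ (subFibre_mono hC' hy'))

/-- **(W1, all orders).**  Under `SysConst β c R x C`: at every base point `x₁ ∈ SubFibre x C` and for every sub-window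
`C' ⊆ C` with `|C'| ≥ 2`, `topCoeff β c R x₁ C' ≡ 0 (mod 2)` — every reduced ANF coefficient of positive order of the
XOR of the tests on the sub-fibre vanishes (`|C'| = 2`: the pair/slope level). -/
theorem topCoeff_even_subwindow (hN : 3 ≤ N) (β : Fin N → Fin N → ZMod 3) (c : Fin N → ZMod 3)
    (R : Finset (Fin N)) {x x₁ : Fin N → Bool} {C C' : Finset (Fin N)} (hC : C ⊆ klineZeros x)
    (hS : SysConst β c R x C) (hx₁ : x₁ ∈ SubFibre x C) (hC' : C' ⊆ C) (h2 : 2 ≤ C'.card) :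
    topCoeff β c R x₁ C' % 2 = 0 := by
  have hx₁' := hx₁
  simp only [SubFibre, mem_filter, mem_univ, true_and] at hx₁'
  obtain ⟨hodd₁, hk₁, -⟩ := hx₁'
  have hCz : C' ⊆ klineZeros x₁ := by
    intro i hi
    have := mem_filter.1 (hC (hC' hi))
    exact mem_filter.2 ⟨this.1, by rw [hk₁]; exact this.2⟩
  exact topCoeff_even_of_sysConst hN β c R hodd₁ hCz h2 (sysConst_subwindow β c R hS hx₁ hC')

end AffBells28lit

end Summit.QuantumAdvantage.AdviceFreeQNC0
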